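import Summits.NavierStokesRegularity.NavierStokesRegularity.Theses.CoriolisHead
import Summits.NavierStokesRegularity.NavierStokesRegularity.Theorems.CoriolisHeadNoCoRotatingCoreNoAxialVelocity
import Literature.Analysis.FluidPDE.DecayingSelfSimilarEulerProfile
import HarnessLib

/-!
# Route CoriolisHead · crux `NoCoRotatingCore` (stmt-NavierStokesRegularity-22676) —
# the strain feed is `⟪curl U, ∂_β U⟫`; RUNG: no co-rotating core when the AXIAL SHEAR is orthogonal
# to the vorticity (Taylor columns `∂_β U ≡ 0` included)

Support file (`--supports stmt-NavierStokesRegularity-22676`; theorems only, no definitions, no named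
facts).  In the lead's skeleton the only obstruction to `NoCoRotatingCore` is the STRAIN FEED
`⟪β, DU[curl U]⟫` of the spin-vorticity identity (`stub_spinVorticityIdentity`:
`L ω_β = 2a ω_β − ⟪β, DU[curl U]⟫`, `ω_β = −tr(B∘DU) = ⟪β, curl U⟫`, `β` the axial vector of the skew
frame rate `B`).  This file identifies the feed geometrically and decides a natural class:

* `inner_fderiv_curl_eq_inner_curl_fderiv` — **the feed is the axial shear seen by the vorticity**:
  `⟪β, DU(y)[curl U(y)]⟫ = ⟪curl U(y), DU(y)[β]⟫ = ⟪ω, ∂_β U⟫` for EVERY field (the antisymmetric part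
  of `DU` is `½ ω ×`, and `⟪ω × ω, β⟫ = 0`; tree: `inner_cross_curl_left`).
* `driftOp_spinVorticity_eq_of_axialShear_orthogonal` — hence on the class
  `⟪curl U(y), DU(y)[β]⟫ = 0` (AXIAL SHEAR ORTHOGONAL TO THE VORTICITY) the spin vorticity is
  exactly damped, `L ω_β = 2a ω_β`, and (`spinVorticity_eq_zero_of_axialShear_orthogonal`) vanishes
  identically for bounded profiles by the Gaussian-weighted energy Liouville theorem
  `eq_zero_of_driftOp_eq_two_mul` (growth input `exists_integral_ball_sq_spinVorticity_le_of_rotated`).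
* `noCoRotatingCore_of_axialShear_orthogonal` — the RUNG in the crux's binders (defect `≡ 0`), and
  `exists_eq_const_of_axialShear_orthogonal` — such bounded profiles are constant
  (`counterRotatingLiouville_proof`).
* `noCoRotatingCore_of_axiallyInvariant`, `exists_eq_const_of_axiallyInvariant` — the sub-class of
  TAYLOR COLUMNS `DU(y)[β] = 0` (profiles invariant along the rotation axis: the 2½-dimensional rotated
  profiles with axial velocity allowed), where the feed vanishes trivially.  This class is NOT covered
  by the earlier rungs (no axial velocity `⟪β, U⟫ ≡ 0`; axisymmetric; helical; small amplitude) — a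
  columnar profile may carry arbitrary bounded axial velocity `u₃(y₁, y₂)`.

The class `⟪curl U, ∂_β U⟫ ≡ 0` contains both the no-axial-velocity class of
`CoriolisHeadNoCoRotatingCoreNoAxialVelocity` (there `⟪β, DU v⟫ = 0` for all `v`) and the Taylor columns.

HONEST FRAMING.  Decided sub-class (zero strain feed), not the crux: for a general profile the feed
`⟪ω, ∂_β U⟫` is unsigned and `NoCoRotatingCore` (⟺ `X`, Pineau–Vicol Conj. 1.1 bounded all-α form)
stays OPEN; Navier–Stokes regularity is NOT proved here.

References: A. J. Majda, A. L. Bertozzi, *Vorticity and Incompressible Flow* (CUP 2002), §1.4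
(1.19)–(1.24) [MajdaBertozziCUP2002]; B. Pineau, V. Vicol, arXiv:2607.09619, (1.8), Conj. 1.1
[PineauVicol2026]; T.-P. Tsai, ARMA 143 (1998), Lemma 3.1 [Tsai1998].
-/

noncomputable section

-- the summit and its single sub-problem share the name (CONVENTIONS §1), as in every Theorems file
set_option linter.dupNamespace false

open MeasureTheory Set Function Filter Topology InnerProductSpace Metric
open scoped RealInnerProductSpace Laplacian ContDiff BigOperators
open Literature.Analysis.FluidPDE
open Summit.NavierStokesRegularity.NavierStokesRegularity.Theses

namespace Summit.NavierStokesRegularity.NavierStokesRegularity.Theorems.CoriolisHead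

/-! ### The strain feed is the axial shear seen by the vorticity -/

/-- **`⟪β, DU[curl U]⟫ = ⟪curl U, DU[β]⟫`** for every field `U`, point `y` and vector `β`: the
antisymmetric part of `DU(y)` is `½ curl U(y) ×`, so `⟪β, DU ω⟫ − ⟪ω, DU β⟫ = ⟪ω × ω, β⟫ = 0` with
`ω = curl U(y)` (tree: `inner_cross_curl_left`).  In the spin-vorticity identity this says: the strain
feed of the co-rotating core equals `⟪ω, ∂_β U⟫`, the axial shear seen by the vorticity.
[cite: MajdaBertozziCUP2002, §1.4 eqs. (1.19)–(1.21)] -/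
theorem inner_fderiv_curl_eq_inner_curl_fderiv
    (U : EuclideanSpace ℝ (Fin 3) → EuclideanSpace ℝ (Fin 3)) (y β : EuclideanSpace ℝ (Fin 3)) :
    ⟪β, fderiv ℝ U y (curl U y)⟫ = ⟪curl U y, fderiv ℝ U y β⟫ := by
  have h := inner_cross_curl_left U y (curl U y) β
  have h0 : cross (curl U y) (curl U y) = 0 := by
    simp [cross]
  rw [h0, inner_zero_left] at h
  linarith

section AxialShear

variable {ν a : ℝ} {B : EuclideanSpace ℝ (Fin 3) →L[ℝ] EuclideanSpace ℝ (Fin 3)}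
  {U : EuclideanSpace ℝ (Fin 3) → EuclideanSpace ℝ (Fin 3)} {P : EuclideanSpace ℝ (Fin 3) → ℝ}

/-- **Zero strain feed ⇒ exact damping.**  For a smooth solution of the rotated profile system whose
AXIAL SHEAR IS ORTHOGONAL TO THE VORTICITY (`⟪curl U(y), DU(y)[β]⟫ = 0`, `β` the axial vector of the
skew `B`), the spin vorticity `ω_β = −Σₗ (B ∂ₗU)ₗ` solves `νΔω_β − Dω_β[U − By + ay] = 2a ω_β`
(`stub_spinVorticityIdentity` and `inner_fderiv_curl_eq_inner_curl_fderiv`).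
[cite: MajdaBertozziCUP2002, §2.1 eq. (2.5) (vorticity equation; here in similarity variables)] -/
theorem driftOp_spinVorticity_eq_of_axialShear_orthogonal (hU : ContDiff ℝ (⊤ : ℕ∞) U)
    (hP : ContDiff ℝ 2 P) (hB : ∀ x, ⟪B x, x⟫ = 0) (hdiv : VectorCalculus.IsDivFree U)
    (heq : ∀ y, -(ν • Laplacian.laplacian U y) + a • U y + a • fderiv ℝ U y y
      + (B (U y) - fderiv ℝ U y (B y)) + convect U U y + gradient P y = 0)
    (hax : ∀ y, ⟪curl U y, fderiv ℝ U y (WithLp.toLp 2 ![(B (EuclideanSpace.single 1 1)) 2,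
        (B (EuclideanSpace.single 2 1)) 0, (B (EuclideanSpace.single 0 1)) 1] :
        EuclideanSpace ℝ (Fin 3))⟫ = 0)
    (y : EuclideanSpace ℝ (Fin 3)) :
    driftOp ν a (fun z => U z - B z)
        (fun z => -(∑ l, (B (fderiv ℝ U z (EuclideanSpace.single l 1))) l)) y
      = 2 * a * ((fun z => -(∑ l, (B (fderiv ℝ U z (EuclideanSpace.single l 1))) l)) y) := by
  rw [stub_spinVorticityIdentity ν a B U P hU hP hB hdiv heq y,
    inner_fderiv_curl_eq_inner_curl_fderiv, hax y, sub_zero]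

/-- **No spin vorticity when the axial shear is orthogonal to the vorticity.**  For a smooth BOUNDED
solution of the rotated Leray profile system (`ν, a > 0`, `B` skew) with `⟪curl U, DU[β]⟫ ≡ 0`, the
spin vorticity vanishes identically, `ω_β = −tr(B∘DU) ≡ 0` (exact damping, then the Gaussian-weighted
energy Liouville theorem with the mean-square growth from Tsai's (3.1)).
[cite: Tsai1998, Lemma 3.1 (3.1) (p. 37)] -/
theorem spinVorticity_eq_zero_of_axialShear_orthogonal (hν : 0 < ν) (ha : 0 < a)
    (hU : ContDiff ℝ (⊤ : ℕ∞) U) (hP : ContDiff ℝ 2 P) (hB : ∀ x, ⟪B x, x⟫ = 0)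
    (hdiv : VectorCalculus.IsDivFree U)
    (heq : ∀ y, -(ν • Laplacian.laplacian U y) + a • U y + a • fderiv ℝ U y y
      + (B (U y) - fderiv ℝ U y (B y)) + convect U U y + gradient P y = 0)
    (hbdd : ∃ M : ℝ, ∀ y, ‖U y‖ ≤ M)
    (hax : ∀ y, ⟪curl U y, fderiv ℝ U y (WithLp.toLp 2 ![(B (EuclideanSpace.single 1 1)) 2,
        (B (EuclideanSpace.single 2 1)) 0, (B (EuclideanSpace.single 0 1)) 1] :
        EuclideanSpace ℝ (Fin 3))⟫ = 0)
    (y : EuclideanSpace ℝ (Fin 3)) :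
    -(∑ l, (B (fderiv ℝ U y (EuclideanSpace.single l 1))) l) = 0 := by
  have hU1 : ContDiff ℝ 1 U := hU.of_le (by norm_cast)
  exact eq_zero_of_driftOp_eq_two_mul hν ha hB hU1 hdiv hbdd (contDiff_spinVorticity hU)
    (driftOp_spinVorticity_eq_of_axialShear_orthogonal hU hP hB hdiv heq hax)
    (exists_integral_ball_sq_spinVorticity_le_of_rotated hν ha hU hP hB hdiv heq hbdd) y

end AxialShear

/-! ### The rungs, in the binders of the crux -/

/-- **RUNG of `NoCoRotatingCore` (bc5 witness with mechanism): no co-rotating core when the AXIAL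
SHEAR IS ORTHOGONAL TO THE VORTICITY.**  The crux `CoriolisHead.NoCoRotatingCore` restricted to profiles
with `⟪curl U(y), DU(y)[β]⟫ = 0` at every point (`β = ((B e₁)₂, (B e₂)₀, (B e₀)₁)` the axial vector of
`B`): for every `ν, a > 0`, skew `B` and every smooth bounded divergence-free such solution `(U, P)` of
the rotated Leray profile system, `0 ≤ Σₗ (B ∂ₗU(y))ₗ` at every point (indeed `= 0`).  Same binders as
the crux plus the one class hypothesis; the crux itself remains open.
[cite: PineauVicol2026, Conjecture 1.1 (arXiv:2607.09619 p. 3)] -/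
theorem noCoRotatingCore_of_axialShear_orthogonal : ∀ (ν a : ℝ), 0 < ν → 0 < a →
    ∀ (B : EuclideanSpace ℝ (Fin 3) →L[ℝ] EuclideanSpace ℝ (Fin 3))
      (U : EuclideanSpace ℝ (Fin 3) → EuclideanSpace ℝ (Fin 3)) (P : EuclideanSpace ℝ (Fin 3) → ℝ),
      ContDiff ℝ (⊤ : ℕ∞) U → ContDiff ℝ 2 P → (∀ x, inner ℝ (B x) x = 0) →
      Literature.Analysis.FluidPDE.VectorCalculus.IsDivFree U →
      (∀ y, -(ν • Laplacian.laplacian U y) + a • U y + a • fderiv ℝ U y y + (B (U y) - fderiv ℝ U y (B y))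
        + Literature.Analysis.FluidPDE.convect U U y + gradient P y = 0) →
      (∃ M : ℝ, ∀ y, ‖U y‖ ≤ M) →
      (∀ y, inner ℝ (curl U y) (fderiv ℝ U y (WithLp.toLp 2 ![(B (EuclideanSpace.single 1 1)) 2,
        (B (EuclideanSpace.single 2 1)) 0, (B (EuclideanSpace.single 0 1)) 1] :
        EuclideanSpace ℝ (Fin 3))) = 0) →
      ∀ y, 0 ≤ ∑ l, (B (fderiv ℝ U y (EuclideanSpace.single l 1))) l := by
  intro ν a hν ha B U P hU hP hB hdiv heq hbdd hax y
  rw [neg_eq_zero.1 (spinVorticity_eq_zero_of_axialShear_orthogonal hν ha hU hP hB hdiv heq hbdd hax y)]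

/-- **Bounded rotated profiles whose axial shear is orthogonal to the vorticity are constant**
(bounded rotated-profile Liouville `X` on the class): the rung feeds the sign into the proved crux
`CounterRotatingLiouville`. [cite: Tsai1998, Thm 1 and Lemma 5.1 (the case B = 0)] -/
theorem exists_eq_const_of_axialShear_orthogonal {ν a : ℝ} (hν : 0 < ν) (ha : 0 < a)
    {B : EuclideanSpace ℝ (Fin 3) →L[ℝ] EuclideanSpace ℝ (Fin 3)}
    {U : EuclideanSpace ℝ (Fin 3) → EuclideanSpace ℝ (Fin 3)} {P : EuclideanSpace ℝ (Fin 3) → ℝ}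
    (hU : ContDiff ℝ (⊤ : ℕ∞) U) (hP : ContDiff ℝ 2 P) (hB : ∀ x, ⟪B x, x⟫ = 0)
    (hdiv : VectorCalculus.IsDivFree U)
    (heq : ∀ y, -(ν • Laplacian.laplacian U y) + a • U y + a • fderiv ℝ U y y
      + (B (U y) - fderiv ℝ U y (B y)) + convect U U y + gradient P y = 0)
    (hbdd : ∃ M : ℝ, ∀ y, ‖U y‖ ≤ M)
    (hax : ∀ y, ⟪curl U y, fderiv ℝ U y (WithLp.toLp 2 ![(B (EuclideanSpace.single 1 1)) 2,
        (B (EuclideanSpace.single 2 1)) 0, (B (EuclideanSpace.single 0 1)) 1] :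
        EuclideanSpace ℝ (Fin 3))⟫ = 0) :
    ∃ b : EuclideanSpace ℝ (Fin 3), ∀ y, U y = b :=
  counterRotatingLiouville_proof ν a hν ha B U P hU hP hB hdiv heq hbdd
    (noCoRotatingCore_of_axialShear_orthogonal ν a hν ha B U P hU hP hB hdiv heq hbdd hax)

/-- **RUNG: no co-rotating core for TAYLOR COLUMNS** — rotated profiles invariant along the rotation
axis, `DU(y)[β] = 0` at every point (2½-dimensional profiles: the velocity, including an arbitrary
axial component, does not depend on the axial coordinate).  On this class the feed `⟪curl U, DU[β]⟫`
vanishes trivially, so the crux's conclusion holds (defect `≡ 0`).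
[cite: PineauVicol2026, Conjecture 1.1 (arXiv:2607.09619 p. 3)] -/
theorem noCoRotatingCore_of_axiallyInvariant : ∀ (ν a : ℝ), 0 < ν → 0 < a →
    ∀ (B : EuclideanSpace ℝ (Fin 3) →L[ℝ] EuclideanSpace ℝ (Fin 3))
      (U : EuclideanSpace ℝ (Fin 3) → EuclideanSpace ℝ (Fin 3)) (P : EuclideanSpace ℝ (Fin 3) → ℝ),
      ContDiff ℝ (⊤ : ℕ∞) U → ContDiff ℝ 2 P → (∀ x, inner ℝ (B x) x = 0) →
      Literature.Analysis.FluidPDE.VectorCalculus.IsDivFree U →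
      (∀ y, -(ν • Laplacian.laplacian U y) + a • U y + a • fderiv ℝ U y y + (B (U y) - fderiv ℝ U y (B y))
        + Literature.Analysis.FluidPDE.convect U U y + gradient P y = 0) →
      (∃ M : ℝ, ∀ y, ‖U y‖ ≤ M) →
      (∀ y, fderiv ℝ U y (WithLp.toLp 2 ![(B (EuclideanSpace.single 1 1)) 2,
        (B (EuclideanSpace.single 2 1)) 0, (B (EuclideanSpace.single 0 1)) 1] :
        EuclideanSpace ℝ (Fin 3)) = 0) →
      ∀ y, 0 ≤ ∑ l, (B (fderiv ℝ U y (EuclideanSpace.single l 1))) l := by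
  intro ν a hν ha B U P hU hP hB hdiv heq hbdd hcol
  exact noCoRotatingCore_of_axialShear_orthogonal ν a hν ha B U P hU hP hB hdiv heq hbdd
    fun y => by rw [hcol y, inner_zero_right]

/-- **Bounded Taylor-column rotated profiles are constant**: a smooth bounded divergence-free solution
of the rotated Leray profile system invariant along the rotation axis (`DU(y)[β] = 0`) is constant —
in particular a columnar profile carries no nontrivial axial velocity either.
[cite: Tsai1998, Thm 1 and Lemma 5.1 (the case B = 0)] -/
theorem exists_eq_const_of_axiallyInvariant {ν a : ℝ} (hν : 0 < ν) (ha : 0 < a)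
    {B : EuclideanSpace ℝ (Fin 3) →L[ℝ] EuclideanSpace ℝ (Fin 3)}
    {U : EuclideanSpace ℝ (Fin 3) → EuclideanSpace ℝ (Fin 3)} {P : EuclideanSpace ℝ (Fin 3) → ℝ}
    (hU : ContDiff ℝ (⊤ : ℕ∞) U) (hP : ContDiff ℝ 2 P) (hB : ∀ x, ⟪B x, x⟫ = 0)
    (hdiv : VectorCalculus.IsDivFree U)
    (heq : ∀ y, -(ν • Laplacian.laplacian U y) + a • U y + a • fderiv ℝ U y y
      + (B (U y) - fderiv ℝ U y (B y)) + convect U U y + gradient P y = 0)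
    (hbdd : ∃ M : ℝ, ∀ y, ‖U y‖ ≤ M)
    (hcol : ∀ y, fderiv ℝ U y (WithLp.toLp 2 ![(B (EuclideanSpace.single 1 1)) 2,
        (B (EuclideanSpace.single 2 1)) 0, (B (EuclideanSpace.single 0 1)) 1] :
        EuclideanSpace ℝ (Fin 3)) = 0) :
    ∃ b : EuclideanSpace ℝ (Fin 3), ∀ y, U y = b :=
  exists_eq_const_of_axialShear_orthogonal hν ha hU hP hB hdiv heq hbdd
    fun y => by rw [hcol y, inner_zero_right]

end Summit.NavierStokesRegularity.NavierStokesRegularity.Theorems.CoriolisHead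

end
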